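import Summits.AtomisticToContinuum.BoseEinsteinCondensation.Theorems.BECRichardsonGaudinRichardsonAnchorBECDefs
import Summits.AtomisticToContinuum.BoseEinsteinCondensation.Theorems.BECRichardsonGaudinRichardsonAnchorBECBornDefs
import Summits.AtomisticToContinuum.BoseEinsteinCondensation.Theorems.BECRichardsonGaudinRichardsonAnchorBECPenalisedLowerBoundCore
import Summits.AtomisticToContinuum.BoseEinsteinCondensation.Theorems.BECRichardsonGaudinRichardsonAnchorBECBornPolyNorms
import Summits.AtomisticToContinuum.BoseEinsteinCondensation.Theorems.BECRichardsonGaudinRichardsonAnchorBECBornPolyKinetic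
import Summits.AtomisticToContinuum.BoseEinsteinCondensation.Theorems.BECRichardsonGaudinRichardsonAnchorBECBornPolyPairAux
import Summits.AtomisticToContinuum.BoseEinsteinCondensation.Theorems.BECRichardsonGaudinRichardsonAnchorBECBornPolyPair
import Summits.AtomisticToContinuum.BoseEinsteinCondensation.Theorems.BECRichardsonGaudinRichardsonAnchorBECEsymmRatioBounds
import Summits.AtomisticToContinuum.BoseEinsteinCondensation.Theorems.BECRichardsonGaudinRichardsonAnchorBECAnchorESector
import Literature.MathematicalPhysics.QuantumManyBody.TorusFockSectorDictionary
import Literature.MathematicalPhysics.QuantumManyBody.BoseGasThermodynamicLimitRuelle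
import HarnessLib

/-!
# Crux `RichardsonAnchorBEC` (stmt-AtomisticToContinuum-14805), line `registered` — the Born upper bound at fixed parameters

`stub_bornFixed`: the energy of the number-conserving Born trial state (sector trial state of `bornTrialPoly`, Theorems/…BornDefs)
at fixed `(N, L, M, R, J₁, T₁, Θ)`: `inf E_Δ ≤ γρN/(2(1+γJ_W)) + (γρN/2)(u/2 + 2δ + δ² + 2^{−T₁}) + 4γρm`, `u = J₁Θ²/p`,
`δ = 2cJ₁Θ`, `m = c²N²p` — the second-Born (pair-bubble) renormalisation `γ → γ/(1+γJ_W)` realised by a number-conserving state,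
with all remainders explicit. Assembly (worker of the lead, blueprint U6a) of the landed `stub_anchorESector` (dictionary),
`stub_bornPolyNorms`, `stub_bornPolyKinetic`, `stub_bornPolyPair` (Fock sums), `stub_esymmRatioBounds` (esymm/ratio inequalities).
-/

noncomputable section

namespace Summit.AtomisticToContinuum.BoseEinsteinCondensation.Cruxes.RichardsonAnchorBEC.Birth

open MeasureTheory Filter
open scoped ENNReal NNReal
open Literature.MathematicalPhysics.QuantumManyBody.BoseGas
open Summit.AtomisticToContinuum.BoseEinsteinCondensation.Theses.BECRichardsonGaudin
open Summit.AtomisticToContinuum.BoseEinsteinCondensation.Cruxes.PeriodicIRBound.LinearPhFloorWagner.WF (normSq innerRe)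

/-- Window symmetry of the Born bound: `σ = Σ_{W₊} θ = L³·J_W`, since `W = W₊ ⊔ (−W₊)` and
`θ(−m) = θ(m)`. [folklore] -/
theorem bornFB_sigma_eq {L : ℝ} {M R : ℕ} (hL : 0 < L)
    (hwin : ∀ f : Momentum → ℝ, ∑ m ∈ pairWindow M R, f m = ∑ m ∈ pairReps M R, (f m + f (-m))) :
    ∑ m ∈ pairReps M R, modeWeight L m = L ^ 3 * windowBubble L M R := by
  have hθ : ∀ m : Momentum, modeWeight L (-m) = modeWeight L m := fun m => by
    simp [modeWeight, waveVector_neg, norm_neg]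
  rw [windowBubble, hwin]
  simp_rw [hθ, ← two_mul, ← Finset.mul_sum]
  have hL3 : L ^ 3 ≠ 0 := by positivity
  field_simp

/-- The ratio of consecutive pair-number weights of the Born trial polynomial:
`λ_{j+1}² (N−2j−2)! = c² (N−2j)(N−2j−1) · λ_j² (N−2j)!`. [folklore] -/
theorem bornFB_coeff_succ (γ L : ℝ) (M R N j : ℕ) (h : 2 * j + 2 ≤ N) :
    bornCoeff γ L M R N (j + 1) ^ 2 * ((N - 2 * (j + 1)).factorial : ℝ) =
      bornCoupling γ L M R ^ 2 * (((N : ℝ) - 2 * j) * ((N : ℝ) - 2 * j - 1)) *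
        (bornCoeff γ L M R N j ^ 2 * ((N - 2 * j).factorial : ℝ)) := by
  rw [bornPair_bornCoeff_succ γ L M R h, show N - 2 * (j + 1) = N - 2 - 2 * j by omega,
    ← bornPair_factorial_cast h]
  ring

/-- `e_j ≥ 0`: the elementary symmetric functions of the squared weights are non-negative. [folklore] -/
theorem bornFB_pairEsymm_nonneg (L : ℝ) (M R j : ℕ) : 0 ≤ pairEsymm L M R j :=
  Finset.sum_nonneg fun _ _ => Finset.prod_nonneg fun _ _ => sq_nonneg _

/-- The size-biased ratio bound of the pair-number weights `W_j = λ_j² (N−2j)! e_j`: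
`(j+1) W_{j+1} ≤ c² N² p · W_j`, from `(j+1) e_{j+1} ≤ p e_j` and `(N−2j)(N−2j−1) ≤ N²`. [folklore] -/
theorem bornFB_W_ratio (γ L : ℝ) (M R N j : ℕ) (h : 2 * j + 2 ≤ N)
    (ha : ((j : ℝ) + 1) * pairEsymm L M R (j + 1) ≤
      (∑ m ∈ pairReps M R, modeWeight L m ^ 2) * pairEsymm L M R j) :
    ((j : ℝ) + 1) * (bornCoeff γ L M R N (j + 1) ^ 2 * ((N - 2 * (j + 1)).factorial : ℝ) *
        pairEsymm L M R (j + 1)) ≤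
      bornCoupling γ L M R ^ 2 * (N : ℝ) ^ 2 * (∑ m ∈ pairReps M R, modeWeight L m ^ 2) *
        (bornCoeff γ L M R N j ^ 2 * ((N - 2 * j).factorial : ℝ) * pairEsymm L M R j) := by
  rw [bornFB_coeff_succ γ L M R N j h]
  have hN : (2 : ℝ) * j + 2 ≤ N := by exact_mod_cast h
  have hP0 : 0 ≤ ((N : ℝ) - 2 * j) * ((N : ℝ) - 2 * j - 1) := mul_nonneg (by linarith) (by linarith)
  have hPN : ((N : ℝ) - 2 * j) * ((N : ℝ) - 2 * j - 1) ≤ (N : ℝ) ^ 2 := by nlinarith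
  have hX : 0 ≤ bornCoeff γ L M R N j ^ 2 * ((N - 2 * j).factorial : ℝ) := by positivity
  have he : 0 ≤ pairEsymm L M R j := bornFB_pairEsymm_nonneg L M R j
  have hp : 0 ≤ ∑ m ∈ pairReps M R, modeWeight L m ^ 2 := Finset.sum_nonneg fun _ _ => sq_nonneg _
  set P := ((N : ℝ) - 2 * j) * ((N : ℝ) - 2 * j - 1)
  set X := bornCoeff γ L M R N j ^ 2 * ((N - 2 * j).factorial : ℝ)
  set c := bornCoupling γ L M R
  set p := ∑ m ∈ pairReps M R, modeWeight L m ^ 2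
  have hcX : 0 ≤ c ^ 2 * X * (p * pairEsymm L M R j) := by positivity
  calc ((j : ℝ) + 1) * (c ^ 2 * P * X * pairEsymm L M R (j + 1))
      = c ^ 2 * P * X * (((j : ℝ) + 1) * pairEsymm L M R (j + 1)) := by ring
    _ ≤ c ^ 2 * P * X * (p * pairEsymm L M R j) := mul_le_mul_of_nonneg_left ha (by positivity)
    _ = P * (c ^ 2 * X * (p * pairEsymm L M R j)) := by ring
    _ ≤ (N : ℝ) ^ 2 * (c ^ 2 * X * (p * pairEsymm L M R j)) := mul_le_mul_of_nonneg_right hPN hcX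
    _ = _ := by ring

/-- Depletion bookkeeping on the band: `Σ_p κ[p ≠ 0] D_p = κ (Σ_p D_p − D_0)` (the zero mode is the
only band mode with label `0`). [folklore] -/
theorem bornFB_sum_ite_zero {M : ℕ} (κ : ℝ) (D : ↥(momentumBand M) → ℝ) :
    ∑ p : ↥(momentumBand M), (if p.1 = 0 then 0 else κ) * D p =
      κ * (∑ p : ↥(momentumBand M), D p - D (toBand M 0)) := by
  have h0 : (toBand M 0).1 = 0 := toBand_val (zero_mem_momentumBand M)
  have key : ∀ p : ↥(momentumBand M), (if p.1 = 0 then 0 else κ) * D p =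
      κ * D p - if p = toBand M 0 then κ * D p else 0 := by
    intro p
    by_cases hp : p = toBand M 0
    · rw [if_pos (by rw [hp, h0]), if_pos hp]; ring
    · rw [if_neg (fun h => hp (Subtype.ext (h.trans h0.symm))), if_neg hp]; ring
  simp_rw [key]
  rw [Finset.sum_sub_distrib, Finset.sum_ite_eq', if_pos (Finset.mem_univ _), ← Finset.mul_sum]
  ring

/-- Kinetic step: from `p e_i ≤ (i+1) e_{i+1} + i Θ² e_i` (`i ≤ J₁`) and `u = J₁Θ²/p`:
`p (1−u) e_i ≤ (i+1) e_{i+1}`. [folklore] -/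
theorem bornFB_kin_step {p u Θ ei ei1 : ℝ} {i J₁ : ℕ} (hp : 0 < p) (hi : i ≤ J₁) (he : 0 ≤ ei)
    (hu : u = J₁ * Θ ^ 2 / p) (hb : p * ei ≤ ((i : ℝ) + 1) * ei1 + i * Θ ^ 2 * ei) :
    p * (1 - u) * ei ≤ ((i : ℝ) + 1) * ei1 := by
  have hiJ : (i : ℝ) ≤ J₁ := by exact_mod_cast hi
  have h1 : (i : ℝ) * Θ ^ 2 * ei ≤ J₁ * Θ ^ 2 * ei :=
    mul_le_mul_of_nonneg_right (mul_le_mul_of_nonneg_right hiJ (sq_nonneg _)) he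
  have hpu : p * u = J₁ * Θ ^ 2 := by rw [hu]; field_simp
  calc p * (1 - u) * ei = p * ei - p * u * ei := by ring
    _ = p * ei - J₁ * Θ ^ 2 * ei := by rw [hpu]
    _ ≤ ((i : ℝ) + 1) * ei1 := by linarith

/-- Kinetic sum: with `F_j ≥ 0` and `p(1−u) e_i ≤ (i+1) e_{i+1}` for `i < J₁`,
`p(1−u) Σ_{1≤j≤J₁} F_j (2σ) e_{j−1} ≤ 2σ Σ_{j≤J₁} j F_j e_j`. [folklore] -/
theorem bornFB_kin_sum (F e : ℕ → ℝ) {p u σ : ℝ} (J₁ : ℕ) (hF : ∀ j, 0 ≤ F j) (hσ : 0 ≤ σ)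
    (hstep : ∀ i, i < J₁ → p * (1 - u) * e i ≤ ((i : ℝ) + 1) * e (i + 1)) :
    p * (1 - u) * ∑ j ∈ Finset.Ico 1 (J₁ + 1), F j * (2 * σ) * e (j - 1) ≤
      2 * σ * ∑ j ∈ Finset.range (J₁ + 1), (j : ℝ) * (F j * e j) := by
  rw [Finset.sum_Ico_eq_sum_range, Nat.add_sub_cancel, Finset.mul_sum, Finset.mul_sum,
    Finset.sum_range_succ']
  simp only [Nat.add_sub_cancel_left, Nat.cast_zero, zero_mul, mul_zero, add_zero]
  refine Finset.sum_le_sum fun i hi => ?_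
  have h := hstep i (Finset.mem_range.1 hi)
  have hFi : 0 ≤ F (1 + i) * (2 * σ) := by have := hF (1 + i); positivity
  calc p * (1 - u) * (F (1 + i) * (2 * σ) * e i) = F (1 + i) * (2 * σ) * (p * (1 - u) * e i) := by ring
    _ ≤ F (1 + i) * (2 * σ) * (((i : ℝ) + 1) * e (i + 1)) := mul_le_mul_of_nonneg_left h hFi
    _ = 2 * σ * (((i + 1 : ℕ) : ℝ) * (F (i + 1) * e (i + 1))) := by rw [Nat.add_comm 1 i]; push_cast; ring

/-- Kinetic conclusion: `K ≤ K'`, `p(1−u)K' ≤ 2σ S`, `S ≤ m Z`, `m = c²N²p` give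
`K ≤ 2σ c² N² (1+2u) Z` (`1/(1−u) ≤ 1 + 2u` for `0 ≤ u ≤ 1/2`). [folklore] -/
theorem bornFB_kin_final {K K' S Z p u σ c Nr : ℝ} (hp : 0 < p) (hu0 : 0 ≤ u) (hu : u ≤ 1 / 2)
    (hσ : 0 ≤ σ) (hZ : 0 ≤ Z) (hK0 : 0 ≤ K) (hK : K ≤ K')
    (hK' : p * (1 - u) * K' ≤ 2 * σ * S) (hS : S ≤ c ^ 2 * Nr ^ 2 * p * Z) :
    K ≤ 2 * σ * c ^ 2 * Nr ^ 2 * (1 + 2 * u) * Z := by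
  have hB : 0 ≤ 2 * σ * c ^ 2 * Nr ^ 2 * Z := by positivity
  have h1 : p * ((1 - u) * K) ≤ p * (2 * σ * c ^ 2 * Nr ^ 2 * Z) := by
    calc p * ((1 - u) * K) = p * (1 - u) * K := by ring
      _ ≤ p * (1 - u) * K' := mul_le_mul_of_nonneg_left hK (by nlinarith)
      _ ≤ 2 * σ * S := hK'
      _ ≤ 2 * σ * (c ^ 2 * Nr ^ 2 * p * Z) := mul_le_mul_of_nonneg_left hS (by positivity)
      _ = p * (2 * σ * c ^ 2 * Nr ^ 2 * Z) := by ring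
  have h2 : (1 - u) * K ≤ 2 * σ * c ^ 2 * Nr ^ 2 * Z := le_of_mul_le_mul_left h1 hp
  have h3 : K ≤ K * (1 + u - 2 * u ^ 2) := by
    have := mul_nonneg hK0 (mul_nonneg hu0 (show (0 : ℝ) ≤ 1 - 2 * u by linarith))
    nlinarith [this]
  calc K ≤ K * (1 + u - 2 * u ^ 2) := h3
    _ = (1 - u) * K * (1 + 2 * u) := by ring
    _ ≤ 2 * σ * c ^ 2 * Nr ^ 2 * Z * (1 + 2 * u) := mul_le_mul_of_nonneg_right h2 (by linarith)
    _ = _ := by ring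

/-- Pair bookkeeping: with `0 ≤ P_j ≤ N²`, `W_j = F_j e_j ≥ 0`, `Σ_{j<J₁} W_j ≤ Z`, `W_{J₁} ≤ t Z`:
`(1−β+δ)² Σ_{j<J₁} F_j P_j e_j + F_{J₁} P_{J₁} e_{J₁} ≤ N² ((1−β+δ)² + t) Z`. [folklore] -/
theorem bornFB_pair_sum (F P e : ℕ → ℝ) {Q B t Z Nr : ℝ} (J₁ : ℕ) (hF : ∀ j, 0 ≤ F j) (he : ∀ j, 0 ≤ e j)
    (hPN : ∀ j, j ≤ J₁ → P j ≤ Nr ^ 2)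
    (hZ : ∑ j ∈ Finset.range (J₁ + 1), F j * e j = Z) (htail : F J₁ * e J₁ ≤ t * Z)
    (hQ : Q ≤ B ^ 2 * ∑ j ∈ Finset.range J₁, F j * P j * e j + F J₁ * P J₁ * e J₁) :
    Q ≤ Nr ^ 2 * (B ^ 2 + t) * Z := by
  have hterm : ∀ j, j ≤ J₁ → F j * P j * e j ≤ Nr ^ 2 * (F j * e j) := by
    intro j hj
    calc F j * P j * e j = P j * (F j * e j) := by ring
      _ ≤ Nr ^ 2 * (F j * e j) := mul_le_mul_of_nonneg_right (hPN j hj) (mul_nonneg (hF j) (he j))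
  have hsum : ∑ j ∈ Finset.range J₁, F j * P j * e j ≤ Nr ^ 2 * Z := by
    calc ∑ j ∈ Finset.range J₁, F j * P j * e j ≤ ∑ j ∈ Finset.range J₁, Nr ^ 2 * (F j * e j) :=
          Finset.sum_le_sum fun j hj => hterm j (Finset.mem_range.1 hj).le
      _ = Nr ^ 2 * ∑ j ∈ Finset.range J₁, F j * e j := by rw [Finset.mul_sum]
      _ ≤ Nr ^ 2 * Z := by
          refine mul_le_mul_of_nonneg_left ?_ (sq_nonneg _)
          rw [← hZ, Finset.sum_range_succ]
          exact le_add_of_nonneg_right (mul_nonneg (hF J₁) (he J₁))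
  have hlast : F J₁ * P J₁ * e J₁ ≤ Nr ^ 2 * (t * Z) :=
    (hterm J₁ le_rfl).trans (mul_le_mul_of_nonneg_left htail (sq_nonneg _))
  calc Q ≤ B ^ 2 * ∑ j ∈ Finset.range J₁, F j * P j * e j + F J₁ * P J₁ * e J₁ := hQ
    _ ≤ B ^ 2 * (Nr ^ 2 * Z) + Nr ^ 2 * (t * Z) :=
        add_le_add (mul_le_mul_of_nonneg_left hsum (sq_nonneg _)) hlast
    _ = _ := by ring

/-- The final algebra of the Born bound: with `c = γ/(2V(1+γJ))`, `σ = VJ`, `ρV = N`, `y = 1/(1+γJ)`: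
`2σc²N² = (γρN/2) y(1−y) ≤ (γρN/2)/4`, `1 − 2cσ = y`, `(γ/2V)N² = γρN/2`, so the kinetic, depletion and
pair estimates sum to `γρN/(2(1+γJ)) + (γρN/2)(u/2 + 2δ + δ² + t) + 4γρm` times `Z`. [folklore] -/
theorem bornFB_final {γ ρ Nr V J c σ u δ t m Z K D Q : ℝ}
    (hγ : 0 < γ) (hρ : 0 < ρ) (hV : 0 < V) (hVN : ρ * V = Nr) (hJ : 0 ≤ J)
    (hc : c = γ / (2 * V * (1 + γ * J))) (hσ : σ = V * J)
    (hu0 : 0 ≤ u) (hδ : 0 ≤ δ) (hZ : 0 < Z)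
    (hK : K ≤ 2 * σ * c ^ 2 * Nr ^ 2 * (1 + 2 * u) * Z)
    (hD : D ≤ 4 * γ * ρ * m * Z)
    (hQ : Q ≤ Nr ^ 2 * ((1 - 2 * c * σ + δ) ^ 2 + t) * Z) :
    (K + D + γ / (2 * V) * Q) / Z ≤
      γ * ρ * Nr / (2 * (1 + γ * J)) + γ * ρ * Nr / 2 * (u / 2 + 2 * δ + δ ^ 2 + t) + 4 * γ * ρ * m := by
  set y : ℝ := 1 / (1 + γ * J) with hy
  have hx : 0 ≤ γ * J := mul_nonneg hγ.le hJ
  have hy0 : 0 < y := by positivity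
  have hy1 : y ≤ 1 := by rw [hy, div_le_one (by positivity)]; linarith
  have hyJ : y * (1 + γ * J) = 1 := by rw [hy]; field_simp
  have hcy : c = γ * y / (2 * V) := by rw [hc, hy]; field_simp
  have hβ : 2 * c * σ = 1 - y := by
    calc 2 * c * σ = γ * J * y := by rw [hcy, hσ]; field_simp
      _ = 1 - y := by linear_combination hyJ
  have hNr : Nr = ρ * V := hVN.symm
  have h2σ : 2 * σ * c ^ 2 * Nr ^ 2 = γ * ρ * Nr / 2 * (y * (1 - y)) := by
    have : 2 * σ * c ^ 2 * Nr ^ 2 = (2 * c * σ) * c * Nr ^ 2 := by ring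
    rw [this, hβ, hcy, hNr]; field_simp
  have hgV : γ / (2 * V) * Nr ^ 2 = γ * ρ * Nr / 2 := by rw [hNr]; field_simp
  have hmain : γ * ρ * Nr / (2 * (1 + γ * J)) = γ * ρ * Nr / 2 * y := by rw [hy]; field_simp
  rw [div_le_iff₀ hZ, hmain]
  have hA : 0 ≤ γ * ρ * Nr / 2 := by rw [hNr]; positivity
  -- kinetic
  have hK2 : K ≤ γ * ρ * Nr / 2 * (y * (1 - y) + u / 2) * Z := by
    have h14 : y * (1 - y) * (1 + 2 * u) ≤ y * (1 - y) + u / 2 := by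
      nlinarith [sq_nonneg (2 * y - 1), mul_nonneg hu0 (sq_nonneg (2 * y - 1))]
    calc K ≤ 2 * σ * c ^ 2 * Nr ^ 2 * (1 + 2 * u) * Z := hK
      _ = γ * ρ * Nr / 2 * (y * (1 - y) * (1 + 2 * u)) * Z := by rw [h2σ]; ring
      _ ≤ γ * ρ * Nr / 2 * (y * (1 - y) + u / 2) * Z :=
          mul_le_mul_of_nonneg_right (mul_le_mul_of_nonneg_left h14 hA) hZ.le
  -- pair
  have hQ2 : γ / (2 * V) * Q ≤ γ * ρ * Nr / 2 * (y ^ 2 + 2 * δ + δ ^ 2 + t) * Z := by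
    have hsq : (y + δ) ^ 2 + t ≤ y ^ 2 + 2 * δ + δ ^ 2 + t := by nlinarith [mul_nonneg hδ hy0.le]
    have hg0 : 0 ≤ γ / (2 * V) := by positivity
    calc γ / (2 * V) * Q ≤ γ / (2 * V) * (Nr ^ 2 * ((1 - 2 * c * σ + δ) ^ 2 + t) * Z) :=
          mul_le_mul_of_nonneg_left hQ hg0
      _ = γ * ρ * Nr / 2 * ((y + δ) ^ 2 + t) * Z := by
          rw [hβ, ← hgV]; ring
      _ ≤ γ * ρ * Nr / 2 * (y ^ 2 + 2 * δ + δ ^ 2 + t) * Z :=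
          mul_le_mul_of_nonneg_right (mul_le_mul_of_nonneg_left hsq hA) hZ.le
  have hsum := add_le_add (add_le_add hK2 hD) hQ2
  calc K + D + γ / (2 * V) * Q ≤ _ := hsum
    _ = _ := by ring

/-- Depletion algebra: `Δ · 2S ≤ 4γρ m Z` from `S ≤ m Z`, `Δ = 2ργ ≥ 0`. [folklore] -/
theorem bornFB_dep {ρ γ S m Z : ℝ} (hρ : 0 ≤ ρ) (hγ : 0 ≤ γ) (hS : S ≤ m * Z) :
    2 * ρ * γ * (2 * S) ≤ 4 * γ * ρ * m * Z := by
  have h := mul_le_mul_of_nonneg_left hS (mul_nonneg hρ hγ)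
  nlinarith [h]

/-- `(N−2j)(N−2j−1) ≤ N²` for `0 ≤ j`, `2j+2 ≤ N`. [folklore] -/
theorem bornFB_PN {Nr j : ℝ} (h1 : 2 * j + 2 ≤ Nr) (h0 : 0 ≤ j) :
    (Nr - 2 * j) * (Nr - 2 * j - 1) ≤ Nr ^ 2 := by
  nlinarith

/-- `β = 2cσ ≤ 1`: with `c = γ/(2V(1+γJ))`, `σ = VJ`, `β = γJ/(1+γJ)`. [folklore] -/
theorem bornFB_beta_le_one {γ V J c σ : ℝ} (hV : 0 < V) (hx : 0 ≤ γ * J)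
    (hc : c = γ / (2 * V * (1 + γ * J))) (hσ : σ = V * J) : 2 * c * σ ≤ 1 := by
  have h : 2 * c * σ = γ * J / (1 + γ * J) := by rw [hc, hσ]; field_simp
  rw [h, div_le_one (by positivity)]
  linarith

/-- **The Born bound at fixed parameters** (registered `stub_bornFixed`; blueprint step U6a): for the sector trial state
of `A = bornTrialPoly γ L M R N J₁` — with `W_j = λ_j²(N−2j)! e_j`, `Z = Σ W_j`, `(j+1)W_{j+1} ≤ mW_j` (`m = c²N²p`), kinetic
`≤ 2σc²N²Z/(1−u)`, depletion `≤ 2mZ`, pair `≤ (g/2)N²Z[(1−β+δ)² + 2^{−T₁}]`, `σ = L³J_W`, `β = γJ_W/(1+γJ_W)` — the anchor's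
infimum is at most `γρN/(2(1+γJ_W)) + (γρN/2)(u/2 + 2δ + δ² + 2^{−T₁}) + 4γρm` (dictionary `stub_anchorESector`, Fock sums
`stub_bornPolyNorms/Kinetic/Pair`, inequalities `stub_esymmRatioBounds`). [folklore] -/
theorem stub_bornFixed :
    ∀ (γ ρ Λ Θ : ℝ) (n R J₁ T₁ : ℕ), 0 < γ → 0 < ρ → 0 ≤ Θ →
      2 * J₁ + 2 ≤ n + 2 → T₁ ≤ J₁ →
      2 * (bornCoupling γ (sideLength ρ (n + 2)) ⌊Λ * sideLength ρ (n + 2) / (2 * Real.pi)⌋₊ R ^ 2 *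
          ((n + 2 : ℕ) : ℝ) ^ 2 *
          ∑ m ∈ pairReps ⌊Λ * sideLength ρ (n + 2) / (2 * Real.pi)⌋₊ R, modeWeight (sideLength ρ (n + 2)) m ^ 2) ≤
        ((J₁ - T₁ : ℕ) : ℝ) →
      0 < ∑ m ∈ pairReps ⌊Λ * sideLength ρ (n + 2) / (2 * Real.pi)⌋₊ R, modeWeight (sideLength ρ (n + 2)) m ^ 2 →
      (J₁ : ℝ) * Θ ^ 2 /
          (∑ m ∈ pairReps ⌊Λ * sideLength ρ (n + 2) / (2 * Real.pi)⌋₊ R, modeWeight (sideLength ρ (n + 2)) m ^ 2) ≤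
        1 / 2 →
      (∀ m ∈ pairReps ⌊Λ * sideLength ρ (n + 2) / (2 * Real.pi)⌋₊ R, modeWeight (sideLength ρ (n + 2)) m ≤ Θ) →
      (⨅ Φ, anchorE γ (2 * ρ * γ) ρ n Λ Φ) ≤
        ENNReal.ofReal
          (γ * ρ * ((n + 2 : ℕ) : ℝ) /
              (2 * (1 + γ * windowBubble (sideLength ρ (n + 2)) ⌊Λ * sideLength ρ (n + 2) / (2 * Real.pi)⌋₊ R)) +
            γ * ρ * ((n + 2 : ℕ) : ℝ) / 2 *
              ((J₁ : ℝ) * Θ ^ 2 /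
                    (∑ m ∈ pairReps ⌊Λ * sideLength ρ (n + 2) / (2 * Real.pi)⌋₊ R,
                      modeWeight (sideLength ρ (n + 2)) m ^ 2) / 2 +
                2 * (2 * bornCoupling γ (sideLength ρ (n + 2)) ⌊Λ * sideLength ρ (n + 2) / (2 * Real.pi)⌋₊ R * J₁ * Θ) +
                (2 * bornCoupling γ (sideLength ρ (n + 2)) ⌊Λ * sideLength ρ (n + 2) / (2 * Real.pi)⌋₊ R * J₁ * Θ) ^ 2 +
                (1 / 2 : ℝ) ^ T₁) +
            4 * γ * ρ *
              (bornCoupling γ (sideLength ρ (n + 2)) ⌊Λ * sideLength ρ (n + 2) / (2 * Real.pi)⌋₊ R ^ 2 *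
                ((n + 2 : ℕ) : ℝ) ^ 2 *
                ∑ m ∈ pairReps ⌊Λ * sideLength ρ (n + 2) / (2 * Real.pi)⌋₊ R, modeWeight (sideLength ρ (n + 2)) m ^ 2)) := by
  intro γ ρ Λ Θ n R J₁ T₁ hγ hρ hΘ h2J hT hm hp hu hθΘ
  have hL : 0 < sideLength ρ (n + 2) := sideLength_succ_succ_pos hρ n
  obtain ⟨hA, hA0, hZ, hD0, hwin, -⟩ :=
    stub_bornPolyNorms γ (sideLength ρ (n + 2)) ⌊Λ * sideLength ρ (n + 2) / (2 * Real.pi)⌋₊ R (n + 2) J₁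
      hL h2J
  refine (iInf_le _ _).trans
    ((stub_anchorESector γ (2 * ρ * γ) ρ Λ n _ hρ _ hA hA0 hγ.le (mul_nonneg (mul_nonneg zero_le_two hρ.le) hγ.le) rfl).trans
      (ENNReal.ofReal_le_ofReal ?_))
  -- notation
  set N : ℕ := n + 2
  set L : ℝ := sideLength ρ N with hLdef
  set M : ℕ := ⌊Λ * L / (2 * Real.pi)⌋₊
  set A := bornTrialPoly γ L M R N J₁
  set c : ℝ := bornCoupling γ L M R
  set σ : ℝ := ∑ m ∈ pairReps M R, modeWeight L m
  set p : ℝ := ∑ m ∈ pairReps M R, modeWeight L m ^ 2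
  -- basic facts: `Z > 0`, `L³ρ = N`, `J_W ≥ 0`, `c ≥ 0`, `σ = L³ J_W`, `β ≤ 1`
  have hZpos : 0 < (Fock.fockInner A A).re := fockInner_self_re_pos hA0
  have hL3 : 0 < L ^ 3 := pow_pos hL 3
  have hVN : ρ * L ^ 3 = (N : ℝ) := by
    rw [hLdef, sideLength_pow_three hρ N]
    field_simp
  have hθ0 : ∀ m : Momentum, 0 ≤ modeWeight L m := bornPair_modeWeight_nonneg L
  have hJ : 0 ≤ windowBubble L M R := by
    unfold windowBubble
    exact mul_nonneg (one_div_nonneg.2 (mul_nonneg zero_le_two hL3.le)) (Finset.sum_nonneg fun m _ => hθ0 m)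
  have hc0 : 0 ≤ c := bornPair_bornCoupling_nonneg hγ.le hL M R
  have hcdef : c = γ / (2 * L ^ 3 * (1 + γ * windowBubble L M R)) := rfl
  have hσL : σ = L ^ 3 * windowBubble L M R := bornFB_sigma_eq hL hwin
  have hσ0 : 0 ≤ σ := Finset.sum_nonneg fun m _ => hθ0 m
  have hx : 0 ≤ γ * windowBubble L M R := mul_nonneg hγ.le hJ
  have hβ1 : 2 * c * σ ≤ 1 := bornFB_beta_le_one hL3 hx hcdef hσL
  have hu0 : 0 ≤ (J₁ : ℝ) * Θ ^ 2 / p := div_nonneg (mul_nonneg (Nat.cast_nonneg _) (sq_nonneg _)) hp.le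
  have hδ0 : 0 ≤ 2 * c * (J₁ : ℝ) * Θ :=
    mul_nonneg (mul_nonneg (mul_nonneg zero_le_two hc0) (Nat.cast_nonneg _)) hΘ
  have hm0 : 0 ≤ c ^ 2 * (N : ℝ) ^ 2 * p := mul_nonneg (mul_nonneg (sq_nonneg _) (sq_nonneg _)) hp.le
  -- the pair-number weights `W_j = λ_j² (N−2j)! e_j` and the elementary symmetric bounds (U3)
  have he0 : ∀ j, 0 ≤ pairEsymm L M R j := bornFB_pairEsymm_nonneg L M R
  have hF0 : ∀ j, 0 ≤ bornCoeff γ L M R N j ^ 2 * ((N - 2 * j).factorial : ℝ) := fun j =>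
    mul_nonneg (sq_nonneg _) (Nat.cast_nonneg _)
  have hW0 : ∀ j, 0 ≤ bornCoeff γ L M R N j ^ 2 * ((N - 2 * j).factorial : ℝ) * pairEsymm L M R j :=
    fun j => mul_nonneg (hF0 j) (he0 j)
  have hxθ : ∀ a ∈ pairReps M R, 0 ≤ modeWeight L a ^ 2 := fun a _ => sq_nonneg _
  have hU3 := fun j => stub_esymmRatioBounds.1 (pairReps M R) (fun m => modeWeight L m ^ 2) hxθ j
  -- (R) the size-biased ratio bound and its two consequences (U3 block 2)
  have hrat : ∀ j, j < J₁ → ((j : ℝ) + 1) *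
      (bornCoeff γ L M R N (j + 1) ^ 2 * ((N - 2 * (j + 1)).factorial : ℝ) * pairEsymm L M R (j + 1)) ≤
      c ^ 2 * (N : ℝ) ^ 2 * p *
        (bornCoeff γ L M R N j ^ 2 * ((N - 2 * j).factorial : ℝ) * pairEsymm L M R j) :=
    fun j hj => bornFB_W_ratio γ L M R N j (by omega) (hU3 j).1
  have hblock2 := stub_esymmRatioBounds.2
    (fun j => bornCoeff γ L M R N j ^ 2 * ((N - 2 * j).factorial : ℝ) * pairEsymm L M R j)
    (c ^ 2 * (N : ℝ) ^ 2 * p) J₁ hW0 hm0 hrat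
  have hS : ∑ j ∈ Finset.range (J₁ + 1), (j : ℝ) *
      (bornCoeff γ L M R N j ^ 2 * ((N - 2 * j).factorial : ℝ) * pairEsymm L M R j) ≤
      c ^ 2 * (N : ℝ) ^ 2 * p * (Fock.fockInner A A).re := by
    rw [hZ]
    exact hblock2.1
  have htail : bornCoeff γ L M R N J₁ ^ 2 * ((N - 2 * J₁).factorial : ℝ) * pairEsymm L M R J₁ ≤
      (1 / 2 : ℝ) ^ T₁ * (Fock.fockInner A A).re := by
    have h := hblock2.2 (J₁ - T₁) (Nat.sub_le _ _) hm
    rw [Nat.sub_sub_self hT] at h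
    rw [hZ]
    exact h
  -- (T) kinetic
  have hXΘ : ∀ a ∈ pairReps M R, modeWeight L a ^ 2 ≤ Θ ^ 2 := fun a ha =>
    pow_le_pow_left₀ (hθ0 a) (hθΘ a ha) 2
  have hstep : ∀ i, i < J₁ → p * (1 - (J₁ : ℝ) * Θ ^ 2 / p) * pairEsymm L M R i ≤
      ((i : ℝ) + 1) * pairEsymm L M R (i + 1) := fun i hi =>
    bornFB_kin_step hp hi.le (he0 i) rfl ((hU3 i).2.1 (Θ ^ 2) hXΘ)
  have hK0 : 0 ≤ ∑ q : ↥(momentumBand M), ‖waveVector L q.1‖ ^ 2 *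
      (Fock.fockInner (MvPolynomial.pderiv q A) (MvPolynomial.pderiv q A)).re :=
    Finset.sum_nonneg fun q _ => mul_nonneg (sq_nonneg _) (Fock.fockInner_self_re_nonneg _)
  have hK := bornFB_kin_final hp hu0 hu hσ0 hZpos.le hK0 (stub_bornPolyKinetic γ L M R N J₁ hL h2J)
    (bornFB_kin_sum (fun j => bornCoeff γ L M R N j ^ 2 * ((N - 2 * j).factorial : ℝ))
      (fun j => pairEsymm L M R j) J₁ hF0 hσ0 hstep) hS
  -- (X) depletion: Euler `Σ_p ‖∂_pA‖² = N‖A‖²` and `N‖A‖² − ‖∂₀A‖² = 2 Σ_j j W_j ≤ 2 m ‖A‖²`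
  have hEuler : ∑ q : ↥(momentumBand M),
      (Fock.fockInner (MvPolynomial.pderiv q A) (MvPolynomial.pderiv q A)).re =
        (N : ℝ) * (Fock.fockInner A A).re := by
    have h := congrArg Complex.re (Fock.sum_fockInner_pderiv_pderiv hA A)
    rw [Complex.re_sum] at h
    rw [h, Complex.mul_re, Complex.natCast_re, Complex.natCast_im, zero_mul, sub_zero]
  have hND : (N : ℝ) * (Fock.fockInner A A).re -
      (Fock.fockInner (MvPolynomial.pderiv (toBand M 0) A) (MvPolynomial.pderiv (toBand M 0) A)).re =
      2 * ∑ j ∈ Finset.range (J₁ + 1), (j : ℝ) *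
        (bornCoeff γ L M R N j ^ 2 * ((N - 2 * j).factorial : ℝ) * pairEsymm L M R j) := by
    rw [hZ, hD0, Finset.mul_sum, Finset.mul_sum, ← Finset.sum_sub_distrib]
    exact Finset.sum_congr rfl fun j _ => by ring
  have hD : 2 * ρ * γ * (∑ q : ↥(momentumBand M),
      (Fock.fockInner (MvPolynomial.pderiv q A) (MvPolynomial.pderiv q A)).re -
      (Fock.fockInner (MvPolynomial.pderiv (toBand M 0) A) (MvPolynomial.pderiv (toBand M 0) A)).re) ≤
      4 * γ * ρ * (c ^ 2 * (N : ℝ) ^ 2 * p) * (Fock.fockInner A A).re := by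
    rw [hEuler, hND]
    exact bornFB_dep hρ.le hγ.le hS
  -- (P) pair
  have hPN : ∀ j, j ≤ J₁ → ((N : ℝ) - 2 * j) * ((N : ℝ) - 2 * j - 1) ≤ (N : ℝ) ^ 2 := fun j hj =>
    bornFB_PN (by exact_mod_cast (show 2 * j + 2 ≤ N by omega)) (Nat.cast_nonneg j)
  have hQ := bornFB_pair_sum (fun j => bornCoeff γ L M R N j ^ 2 * ((N - 2 * j).factorial : ℝ))
    (fun j => ((N : ℝ) - 2 * j) * ((N : ℝ) - 2 * j - 1)) (fun j => pairEsymm L M R j) J₁ hF0 he0 hPN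
    hZ.symm htail (stub_bornPolyPair γ L Θ M R N J₁ hL hγ.le hΘ h2J hθΘ hβ1)
  -- (E) split the one-body sum and conclude with the final algebra
  have hsplit : (∑ q : ↥(momentumBand M), (‖waveVector L q.1‖ ^ 2 + if q.1 = 0 then 0 else 2 * ρ * γ) *
        (Fock.fockInner (MvPolynomial.pderiv q A) (MvPolynomial.pderiv q A)).re) =
      (∑ q : ↥(momentumBand M), ‖waveVector L q.1‖ ^ 2 *
          (Fock.fockInner (MvPolynomial.pderiv q A) (MvPolynomial.pderiv q A)).re) +
        ∑ q : ↥(momentumBand M), (if q.1 = 0 then 0 else 2 * ρ * γ) *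
          (Fock.fockInner (MvPolynomial.pderiv q A) (MvPolynomial.pderiv q A)).re := by
    rw [← Finset.sum_add_distrib]
    exact Finset.sum_congr rfl fun q _ => add_mul _ _ _
  rw [hsplit, bornFB_sum_ite_zero]
  exact bornFB_final hγ hρ hL3 hVN hJ hcdef hσL hu0 hδ0 hZpos hK hD hQ

end Summit.AtomisticToContinuum.BoseEinsteinCondensation.Cruxes.RichardsonAnchorBEC.Birth

end
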